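import Literature.Geometry.Riemannian.GradientShrinker
import Literature.Geometry.Riemannian.ShrinkerEntropy
import Literature.Geometry.Riemannian.GaussBonnetGradient
import HarnessLib

/-!
# Sketch — crux-ideate `stmt-SmoothPoincare4-10868` (NoncompactShrinkerGap), ideator 2, round 1

First checkable statements ("First lemma" fields) of the idea cards
`Ideas/cone-entropy-ceiling.md` and `Ideas/level-set-entropic-necks.md`, typed over the tree's
shrinker / Perelman-entropy vocabulary (`GradientShrinker.lean`, `ShrinkerEntropy.lean`,
`PerelmanEntropy.lean`, `GaussBonnetGradient.grad`). Nothing is proved here; every `def` is a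
`Prop` that elaborates.
-/

noncomputable section

open Bundle Set Module Filter MeasureTheory Manifold
open scoped ContDiff Topology ENNReal NNReal

namespace Summit.SmoothPoincare4.SmoothPoincare4.Cruxes.NoncompactShrinkerGap.Sketch

open Literature.Geometry.Riemannian Literature.Geometry.Lorentzian

/-- **All-scales ceiling** (shared first lemma of both cards; CHI 2004 Thm 3.4 `Θ = e^{ν}` in its
one-sided, test-function form). For a complete normalised gradient shrinker `(Mⁿ, g, f)`
(`Ric + Hess f = g/2`, `R + |∇f|² = f`, closed `g`-balls compact) put
`c := log((4π)^{-n/2} ∫ e^{-f} dV) = log Θ`. Then for EVERY scale `τ > 0` (not only `τ = 1`,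
which is `CarrilloNi2009_shrinkerLSI` (ii)) and every smooth `ψ` compatible at scale `τ` whose
density has bounded second moment and integrable `𝒲`-integrand, `c ≤ 𝒲(g, ψ, τ)`.
Equivalently `log Θ = μ(g,1) = min_τ μ(g,τ) = ν(g)`. PRINTED: Li–Wang 2020 (Heat kernel on Ricci shrinkers, arXiv:1901.05691) Thm 1.1 — for ANY
complete shrinker, no curvature assumption, `τ ↦ μ(g,τ)` decreases on `(0,1]` and increases on
`[1,∞)`, so `ν(g) = μ(g,1)` (Perelman's monotonicity on the shrinker's own flow with `T = ±1`),
plus Carrillo–Ni Cor. 4.1 / Li–Wang 2019 (2.5) at `s = 1` (`μ(g,1) = log Θ`). USE: any test pair `(ψ, τ)` with `𝒲(g,ψ,τ) ≤ ν_cyl` proves the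
crux for that shrinker — cone test functions (card 1), level-set slabs (card 2). -/
def AllScalesCeiling : Prop :=
  ∀ (n : ℕ) (M : Type) [TopologicalSpace M] [T2Space M] [SecondCountableTopology M]
    [ChartedSpace (EuclideanSpace ℝ (Fin n)) M] [IsManifold (𝓡 n) ∞ M] [ConnectedSpace M]
    [T3Space M] [MeasurableSpace M] [BorelSpace M]
    (g : PseudoRiemannianMetric (𝓡 n) ∞ (EuclideanSpace ℝ (Fin n)) (TangentSpace (𝓡 n) : M → Type _))
    [g.HasLeviCivita] (f : M → ℝ), g.IsRiemannian →
      (∀ (x : M) (r : NNReal), IsCompact {y : M | g.riemEDist x y ≤ r}) →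
      ContMDiff (𝓡 n) 𝓘(ℝ, ℝ) ∞ f →
      g.IsNormalisedShrinker f 1 →
        let c : ℝ := Real.log ((4 * Real.pi) ^ (-(n : ℝ) / 2) * ∫ x, Real.exp (-f x) ∂g.riemVolume)
        ∀ τ : ℝ, 0 < τ → ∀ ψ : M → ℝ, ContMDiff (𝓡 n) 𝓘(ℝ, ℝ) ∞ ψ → g.IsEntropyCompatible ψ τ →
          (∃ o : M, Integrable (fun x ↦ (g.riemEDist o x).toReal ^ 2 * entropyDensity n ψ τ x)
            g.riemVolume) →
          Integrable (fun x ↦ (τ * (g.scalarCurvature x + g.gradSq ψ x) + ψ x - n) *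
            entropyDensity n ψ τ x) g.riemVolume →
          c ≤ g.wEntropy g.leviCivita ψ τ

/-- **Card 1, quantitative form of the cone ceiling for RADIAL test functions**: the explicit
one-variable functional `F`. For `κ ≥ 0`,
`F(κ) := inf { ∫₀^∞ (φ'² + φ - 4 + κ/r²) dm_φ : dm_φ = e^{-φ(r)} r³ dr / 8, ∫ dm_φ = 1 }`
(the `𝒲`-functional at `τ = 1` of `ℝ⁴` with the Hardy potential `κ/r²`, over radial profiles).
Typed as the predicate "`a` is a lower bound of the admissible values", so that
`F(κ) = sSup {a | RadialConeFunctionalLB κ a}`; `F(0) = 0` (Gaussian soliton), `F(κ) ≤ κ/4`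
(Gaussian test profile, `⟨r⁻²⟩ = 1/4`). The card's ceiling reads: for an end of a complete 4-d
shrinker smoothly asymptotic to the cone `C(N,h)`, `log Θ ≤ ν(C(N)) ≤ log(Vol(N,h)/2π²) + F(R̄_h - 6)`. -/
def RadialConeFunctionalLB (κ a : ℝ) : Prop :=
  ∀ φ : ℝ → ℝ, ContDiff ℝ 2 φ →
    ∫ r in Ioi (0 : ℝ), Real.exp (-φ r) * r ^ 3 / 8 = 1 →
    Integrable (fun r ↦ ((deriv φ r) ^ 2 + φ r - 4 + κ / r ^ 2) * (Real.exp (-φ r) * r ^ 3 / 8))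
      (volume.restrict (Ioi 0)) →
    a ≤ ∫ r in Ioi (0 : ℝ), ((deriv φ r) ^ 2 + φ r - 4 + κ / r ^ 2) * (Real.exp (-φ r) * r ^ 3 / 8)

/-- **Card 2, mechanism identity** (`Ric(∇f,∇f) = ½ ⟨∇R, ∇f⟩` on a gradient shrinker; equivalently
on a regular level set `Σ_s = {f = s}` with unit normal `ν = ∇f/|∇f|`, `Ric(ν,ν) = ½ dR/ds` along
the normalised gradient flow). Classical (from `div Ric = dR/2` and the soliton equation:
`∇R = 2 Ric(∇f)`), recorded e.g. in Eminenti–La Nave–Mantegazza 2008 and Petersen–Wylie 2009; it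
is the sign-carrier of the level-set slab test functions: slices across which `R` decays are
entropic necks. Typed with the tree's `grad` (`GaussBonnetGradient.lean`). -/
def RicciAlongGradient : Prop :=
  ∀ (n : ℕ) (M : Type) [TopologicalSpace M] [T2Space M] [SecondCountableTopology M]
    [ChartedSpace (EuclideanSpace ℝ (Fin n)) M] [IsManifold (𝓡 n) ∞ M]
    (g : PseudoRiemannianMetric (𝓡 n) ∞ (EuclideanSpace ℝ (Fin n)) (TangentSpace (𝓡 n) : M → Type _))
    [g.HasLeviCivita] (f : M → ℝ) (τ : ℝ), g.IsRiemannian → 0 < τ →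
      ContMDiff (𝓡 n) 𝓘(ℝ, ℝ) ∞ f → g.IsGradientShrinker f τ →
      ∀ x : M, g.ricci x (grad g f x) (grad g f x) =
        (1 / 2 : ℝ) * g.val x (grad g (fun y ↦ g.scalarCurvature y) x) (grad g f x)

/-- **Card 2, first checkable statement (slab bound, product case = sanity anchor)**: on the
exact cylinder the slab test function is optimal. Abstractly: for normalised shrinker data as in
the crux and ANY smooth compatible `ψ` at ANY scale, `log Θ ≤ 𝒲(g,ψ,τ)` (`AllScalesCeiling`);
the card's slab inequality specialises `ψ = d_Σ²/4τ + φ ∘ π` near a closed two-sided hypersurface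
`Σ` and asserts `𝒲(g,ψ,τ) ≤ μ(Σ,h_Σ,τ) + τ·⟨Ric(ν,ν)⟩_φ + Err(Σ,τ)`; typing `d_Σ`, Fermi
coordinates and `Err` needs a tubular-neighbourhood API the tree lacks (definition request on the
card). What IS typable now is the averaged sign-carrier it feeds on: the Gaussian covariance
identity `∫ Ric(∇f,∇f) e^{-f} dV = ½ ∫ R (f - n/2) e^{-f} dV` (integrate `RicciAlongGradient`
against `e^{-f}` using `div(e^{-f}∇f) = (n/2 - f) e^{-f}`). -/
def RicciGradientCovariance : Prop :=
  ∀ (n : ℕ) (M : Type) [TopologicalSpace M] [T2Space M] [SecondCountableTopology M]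
    [ChartedSpace (EuclideanSpace ℝ (Fin n)) M] [IsManifold (𝓡 n) ∞ M] [ConnectedSpace M]
    [T3Space M] [MeasurableSpace M] [BorelSpace M]
    (g : PseudoRiemannianMetric (𝓡 n) ∞ (EuclideanSpace ℝ (Fin n)) (TangentSpace (𝓡 n) : M → Type _))
    [g.HasLeviCivita] (f : M → ℝ), g.IsRiemannian →
      (∀ (x : M) (r : NNReal), IsCompact {y : M | g.riemEDist x y ≤ r}) →
      ContMDiff (𝓡 n) 𝓘(ℝ, ℝ) ∞ f → g.IsNormalisedShrinker f 1 →
      ∫ x, g.ricci x (grad g f x) (grad g f x) * Real.exp (-f x) ∂g.riemVolume =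
        (1 / 2 : ℝ) * ∫ x, g.scalarCurvature x * (f x - n / 2) * Real.exp (-f x) ∂g.riemVolume

end Summit.SmoothPoincare4.SmoothPoincare4.Cruxes.NoncompactShrinkerGap.Sketch

end
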